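import Summits.BirchSwinnertonDyer.Rank1Residual.Additive.X3BranchLambda
import Summits.BirchSwinnertonDyer.Rank1Residual.Additive.CongruentPartnerMainConjecture
import Literature.NumberTheory.EllipticCurves.Rank1Residual.Predicates
import HarnessLib

/-!
# X3 on the semistable-twist locus: "GREENBERG–VATSAL ON THE BRANCH" DECOMPOSED along the isogeny
# characters of the ADDITIVE curve — the branch parity condition, the two `λ`-halves (analytic /
# algebraic) as TYPED equalities `λ = n`, and the kernel composition into `X3BranchLambdaEqAt`,
# `X3BranchAnalyticMuZeroAt` and (granted Wuthrich's half) `X3BranchMainConjectureAt`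
# (cell `bsd-eis`, seat `bsd-eis-x3`, programme FULL-BSD-RANK1 tranche 1a, row B2/B6 X3-share)

HONEST FRAMING (cell `bsd-eis`, `run/shared/lean/pub/bsd-eis/`, memo `X3-BRANCH-GV-MEMO.md`): X3
(additive `p`, `E[p]` reducible) stays CONSTRUCTION-SHAPED; nothing here is a class theorem and NO
Literature fact is minted. This file TYPES the decomposition found by the seat and proves only the
`Λ`-algebra that composes it (0 named facts, 0 `sorry`).

## The decomposition (memo `x3-MEMO-1.md` §0–§3; numerics = EVIDENCE only: `branchgv.gp`, kit j236365, j236388, j236427, j236429, j236439 (x41 census N ≤ 3000), j236491 — the analytic identity below holds on 77/77 non-degenerate branch rows, 140/140 degenerate rows (p = 3, E[3]^{ss} = {1,ω}, pole convention λ(ζ_3) = −1) and 64/64 trivial-branch controls = GV Thm. (1.3) itself)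

`(E, p)` an X3 pair with semistability defect `2`; `V := E ⊗ χ_{p*}` (good ordinary or
multiplicative at `p`), `m = (p−1)/2`, `χ = ω^m = χ_{p*}`. Write `V[p]^{ss} = ψ_V ⊕ φ_V` with `ψ_V`
the constituent UNRAMIFIED at `p` (`ψ_V(Frob_p) = a_p(V)`), `φ_V = ω ψ_V⁻¹`; then
`E[p]^{ss} = ψ_E ⊕ φ_E`, `ψ_E := χψ_V` (`ψ_E|_{I_p} = ω^m`), `φ_E := χφ_V = ωψ_E⁻¹`
(`φ_E|_{I_p} = ω^{m+1}`). On the `ω^m`-branch of `V` over `ℚ(μ_{p^∞})` — which IS the Iwasawa theory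
of the additive `E` over `ℚ_∞` (twist descent; Delbourgo 1998 (G)/(M)) — Greenberg–Vatsal's
method runs along `0 → Φ_E → E[p] → Ψ_E → 0` PROVIDED `ψ_E` is ODD (⟺ `χ(−1) = −ψ_V(−1)`, the
hypothesis of GV Thm. (3.12) at `χ = ω^m`; for `m` even it is `GVPar V p`, for `m` odd its
OPPOSITE): then `μ = 0` on both sides and
`λ(ϖ·L_p(V, ω^m, T)) = λ(char e_m X(V/ℚ(μ_{p^∞}))) = 2·λ(L_p(φ_E, s)) + Σ_{ℓ ∈ Σ₀} s_ℓ t_ℓ(E)`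
(GV p. 30), the analytic half by GV Thm. (3.11)/(3.12) with (28) at `χ = ω^m` (PRINTED for `V`
good ordinary, `p ∤ N_V`; NOT printed for `V` multiplicative), the algebraic half by GV §2 (16),
Props. (2.1)–(2.8) at the datum `(E[p^∞], ramified ordinary line)` over `ℚ_∞` with
Ferrero–Washington + Mazur–Wiles for `φ_E` (even) and `ψ_E` (odd, ramified at `p`).

## Contents (all `def`s are hypothesis shapes, nothing asserted; all theorems are `Λ`-algebra)

* `BranchGVParAt V p` — the branch parity condition in the tree's `IsRationalLine` /
  `LineUnramifiedAt` / `LineEven` / `LineOdd` vocabulary; `branchGVParAt_iff_gvPar` (`m` even).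
* `X3BranchAnalyticLambdaAt V p n` — "the branch series `ϖ·B_m` has a unit coefficient and
  `λ(ϖ·B_m) = n`" (`normLam`), in the telescope of `X3BranchAnalyticMuZeroAt`.
* `X3BranchAlgebraicLambdaAt V p n` — "every generator of `char X_m` has unit content and `λ = n`"
  (`X1.MuLambda.lam`), in the telescope of `X3BranchLambdaEqAt` (half-eigen data `D`).
* `x3BranchAnalyticMuZeroAt_of_analyticLambda`, `x3BranchLambdaEqAt_of_analyticLambda_of_algebraicLambda`,
  `x3BranchMainConjectureAt_of_analyticLambda_of_algebraicLambda` — the two halves with the SAME `n`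
  give the tree's typed targets (and, with Wuthrich's Thm. 16, the branch main conjecture).

The decomposition's CLAIM (memo §2, not typed as a fact here): `BranchGVParAt V p` ⟹ both halves
hold with `n = 2·λ(L_p(φ_E,·)) + Σ s_ℓ t_ℓ(E)` — for the member of the isogeny class with `μ = 0`.

References: [GreenbergVatsal2000] Thm. (1.3), §2 (16) pp. 28–30, §3 Thm. (3.11)/(3.12), (28),
Cor. (3.8); [Wuthrich2014] Thm. 16; [Delbourgo1998] §2.5 p. 151; [MazurTateTeitelbaum1986Invent]
§I.13; Lei–Pollack–Pratap arXiv:2412.16629 Thm. 1 (the branch identification for Mazur–Tate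
elements); [Washington1997] §7.1.
-/

set_option autoImplicit false

noncomputable section

open scoped Classical MatrixGroups ModularForm

open CongruenceSubgroup WeierstrassCurve Literature.NumberTheory.EllipticCurves
  Literature.NumberTheory.EllipticCurves.ModularForms
  Literature.NumberTheory.EllipticCurves.GreenbergVatsal2000
  Literature.NumberTheory.EllipticCurves.Rank1Residual
  Literature.NumberTheory.GaloisRepresentations
  Summit.BirchSwinnertonDyer.Rank1Residual.X1.MuLambda
  Summit.BirchSwinnertonDyer.Rank1Residual.X11a.LambdaNorm

namespace Summit.BirchSwinnertonDyer.Rank1Residual.Additive.X3Branch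

/-! ### §1 The branch parity condition -/

section Parity

variable (V : WeierstrassCurve ℚ) (p : ℕ) [Fact p.Prime]

/-- **The branch Greenberg–Vatsal parity condition** for a semistable-at-`p` curve `V` with `V[p]`
reducible, read on the `ω^{(p−1)/2}`-branch (i.e. for the additive twist `E = V ⊗ χ_{p*}`): the
constituent `ψ_E = χ_{p*}·ψ_V` of `E[p]^{ss}` is ODD, equivalently `χ_{p*}(−1) = −ψ_V(−1)` where
`ψ_V` is the constituent of `V[p]^{ss}` unramified at `p` — the hypothesis "`χ(−1) = −ψ(−1)`" of
Greenberg–Vatsal's Thm. (3.12) at `χ = ω^{(p−1)/2}`. In the tree's line vocabulary: some rational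
`p`-isogeny kernel `Φ` of `V` is (ramified-at-`p` ∧ even) ∨ (unramified ∧ odd) when `(p−1)/2` is
even (`p ≡ 1 (mod 4)`: literally `GVPar V p`), and (ramified ∧ odd) ∨ (unramified ∧ even) when
`(p−1)/2` is odd (`p ≡ 3 (mod 4)`: the OPPOSITE of `GVPar`, e.g. every `V` with a rational
`3`-torsion point at `p = 3`). A definition; nothing asserted.
[cite: GreenbergVatsal2000, Thm. (1.3) (hypothesis on Φ) and §3 Thm. (3.12) (hypothesis χ(−1) = −ψ(−1))] -/
def BranchGVParAt : Prop :=
  ∃ Φ : AddSubgroup (geomTorsion V (p : ℤ)), IsRationalLine V p Φ ∧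
    (Even (p / 2) →
      ((¬ LineUnramifiedAt V p Φ ∧ LineEven V p Φ) ∨ (LineUnramifiedAt V p Φ ∧ LineOdd V p Φ))) ∧
    (¬ Even (p / 2) →
      ((¬ LineUnramifiedAt V p Φ ∧ LineOdd V p Φ) ∨ (LineUnramifiedAt V p Φ ∧ LineEven V p Φ)))

/-- On an even branch (`p ≡ 1 (mod 4)`) the branch parity condition is literally Greenberg–Vatsal's
`GVPar V p`. [cite: GreenbergVatsal2000, Thm. (1.3) (hypothesis on Φ)] -/
theorem branchGVParAt_iff_gvPar (h : Even (p / 2)) : BranchGVParAt V p ↔ GVPar V p := by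
  unfold BranchGVParAt GVPar
  refine exists_congr fun Φ => ?_
  constructor
  · rintro ⟨hΦ, heven, -⟩
    exact ⟨hΦ, heven h⟩
  · rintro ⟨hΦ, hpar⟩
    exact ⟨hΦ, fun _ => hpar, fun hodd => absurd h hodd⟩

/-- On an odd branch (`p ≡ 3 (mod 4)`, `p = 3` included) the branch parity condition is the
OPPOSITE parity: (ramified ∧ odd) ∨ (unramified ∧ even).
[cite: GreenbergVatsal2000, §3 Thm. (3.12) (hypothesis χ(−1) = −ψ(−1))] -/
theorem branchGVParAt_iff_of_odd (h : ¬ Even (p / 2)) :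
    BranchGVParAt V p ↔ ∃ Φ : AddSubgroup (geomTorsion V (p : ℤ)), IsRationalLine V p Φ ∧
      ((¬ LineUnramifiedAt V p Φ ∧ LineOdd V p Φ) ∨ (LineUnramifiedAt V p Φ ∧ LineEven V p Φ)) := by
  unfold BranchGVParAt
  refine exists_congr fun Φ => ?_
  constructor
  · rintro ⟨hΦ, -, hodd⟩
    exact ⟨hΦ, hodd h⟩
  · rintro ⟨hΦ, hpar⟩
    exact ⟨hΦ, fun heven => absurd heven h, fun _ => hpar⟩

end Parity

/-! ### §2 The two halves of Greenberg–Vatsal on the branch, TYPED as `λ = n` -/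

section Halves

variable (V : WeierstrassCurve ℚ) [V.IsElliptic] [V.IsGloballyMinimal] (p : ℕ) [Fact p.Prime]

/-- **The ANALYTIC half on the branch, typed**: for the branch series `B = L_p(f, α, ω^{(p−1)/2}, T)`
of the newform `f` of `V` (reduction-type disjunction and period ratio `ϖ` exactly as in
`X3BranchAnalyticMuZeroAt V p`), `ϖ·B` has a coefficient of `p`-adic norm `1` (`μ_an = 0`) AND its
`λ`-invariant (`normLam`, the index of the first coefficient of maximal norm) is `n`. The
decomposition predicts `n = 2·λ(L_p(φ_E,·)) + Σ_{ℓ∈Σ₀} s_ℓ t_ℓ(E)` under `BranchGVParAt V p`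
(Greenberg–Vatsal Thm. (3.11)/(3.12) with (28) at `χ = ω^{(p−1)/2}`, PRINTED for `V` good ordinary
with `p ∤ N_V`; p. 43: "the `λ`-invariant of `L(G, χ, T)` is equal to `λ_{χφ,Σ₀} + λ_{χψ,Σ₀}`").
A hypothesis shape; nothing asserted. [cite: GreenbergVatsal2000, §3 Thm. (3.11), Thm. (3.12), (28) and p. 43] -/
def X3BranchAnalyticLambdaAt (n : ℕ) : Prop :=
  ∀ {N : ℕ} [NeZero N] (f : CuspForm (Gamma0 N) 2) (B : PowerSeries ℚ_[p]) (ϖ : ℚ),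
    ((IsOrdinaryAt V p ∧
        B = if Even (p / 2) then padicLFunctionBranch f ((unitRoot V p : ℤ_[p]) : ℚ_[p]) (p / 2)
          else padicLFunctionMinusBranch f ((unitRoot V p : ℤ_[p]) : ℚ_[p]) (p / 2)) ∨
      (V.HasSplitMultiplicativeReductionAtPrime p ∧
        B = if Even (p / 2) then padicLFunctionPlusBranchMult f (1 : ℚ_[p]) (p / 2)
          else padicLFunctionMinusBranchMult f (1 : ℚ_[p]) (p / 2)) ∨
      (V.HasMultiplicativeReductionAtPrime p ∧ ¬ V.HasSplitMultiplicativeReductionAtPrime p ∧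
        B = if Even (p / 2) then padicLFunctionPlusBranchMult f (-1 : ℚ_[p]) (p / 2)
          else padicLFunctionMinusBranchMult f (-1 : ℚ_[p]) (p / 2))) →
    IsNewformOf V f →
    (if Even (p / 2) then (ϖ : ℝ) * V.realPeriodRat = plusPeriod f
      else (ϖ : ℝ) * V.imaginaryPeriodRat = minusPeriod f) →
    (∃ k, ‖PowerSeries.coeff k (PowerSeries.C (ϖ : ℚ_[p]) * B)‖ = 1) ∧
      normLam (PowerSeries.C (ϖ : ℚ_[p]) * B) = n

/-- **The ALGEBRAIC half on the branch, typed**: every generator `g` of the characteristic ideal of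
every half-eigen dual datum `D` (`X_m = e_m X(V/ℚ(μ_{p^∞}))`, telescope exactly as in
`X3BranchLambdaEqAt V p`) has unit content (`μ_alg = 0`) and `λ(g) = n` (`X1.MuLambda.lam`). The
decomposition predicts the SAME `n = 2·λ(L_p(φ_E,·)) + Σ_{ℓ∈Σ₀} s_ℓ t_ℓ(E)` under
`BranchGVParAt V p` (Greenberg–Vatsal §2 (16) and p. 30, run at the datum `(E[p^∞], ramified
ordinary line)` over `ℚ_∞` — "`λ_E = 2λ_φ + Σ_{ℓ∈Σ₀} s_ℓ t_ℓ(E)`" — together with twist descent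
`e_m X(V/ℚ(μ_{p^∞})) = X(E/ℚ_∞)`). A hypothesis shape; nothing asserted.
[cite: GreenbergVatsal2000, §2 (16) p. 29 and p. 30] [cite: Wuthrich2014, Thm. 16 (p. 397) (binder shape)] -/
def X3BranchAlgebraicLambdaAt (n : ℕ) : Prop :=
  ∀ (K : Type) [Field K] [NumberField K] [(galRange (K := ℚ) K).Normal]
    (F : Type) [Field F] [NumberField F] [IsCyclotomicExtension {p} ℚ F]
    [(galRange (K := ℚ) F).Normal]
    {κ : ZpExtension ℚ p} {γ : Field.absoluteGaloisGroup ℚ},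
    p ≠ 2 → Module.finrank ℚ K = 2 →
    (∃ θ : K, θ ^ 2 = algebraMap ℚ K ((-1) ^ (p / 2) * p)) →
    ¬ V.HasIrreducibleModPGaloisRep p →
    κ.IsCyclotomic → κ.IsTopGenerator γ → IsCyclotomicVariable p γ →
    γ ∈ galRange (K := ℚ) K → γ ∈ galRange (K := ℚ) F →
    ∀ (D : V.EigenSelmerDualData p
        (κ.kerSubgroup ⊓ galRange (K := ℚ) K ⊓ galRange (K := ℚ) F) κ.kerSubgroup
        (fun g ↦ if g ∈ galRange (K := ℚ) K then 1 else -1) γ)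
      (g : IwasawaAlgebra p), D.charIdeal = Ideal.span {g} → HasUnitContent g ∧ lam g = n

end Halves

/-! ### §3 The kernel composition: equal `λ` on both halves gives the tree's typed targets -/

section Kernel

variable {V : WeierstrassCurve ℚ} [V.IsElliptic] [V.IsGloballyMinimal] {p : ℕ} [Fact p.Prime]

omit [V.IsElliptic] in
/-- The analytic half (for any `n`) contains the analytic `μ = 0` bit `X3BranchAnalyticMuZeroAt V p`.
[cite: GreenbergVatsal2000, p. 43 ("The vanishing of μ^{anal}_E also follows from the congruence")] -/
theorem x3BranchAnalyticMuZeroAt_of_analyticLambda {n : ℕ} (hA : X3BranchAnalyticLambdaAt V p n) :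
    X3BranchAnalyticMuZeroAt V p :=
  fun f B ϖ hred hf hϖ => (hA f B ϖ hred hf hϖ).1

omit [V.IsElliptic] [V.IsGloballyMinimal] in
/-- `λ` of an element `g' ∈ Λ` of unit content with `ι g' = C(u·ϖ)·B`, `u ∈ ℤ_pˣ`, is the
`normLam` of the `ℚ_p`-series `C(ϖ)·B` (scale invariance of `λ`, Washington §7.1).
[cite: Washington1997, §7.1] -/
theorem lam_eq_normLam_of_iota_eq {g' : IwasawaAlgebra p} {u : ℤ_[p]ˣ} {ϖ : ℚ}
    {B : PowerSeries ℚ_[p]} (hμ : HasUnitContent g')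
    (hι : iwasawaToPowerSeries p g' = PowerSeries.C (((u : ℤ_[p]) : ℚ_[p]) * (ϖ : ℚ_[p])) * B) :
    lam g' = normLam (PowerSeries.C (ϖ : ℚ_[p]) * B) := by
  have hu : ‖(((u : ℤ_[p]) : ℚ_[p]))‖ ≠ 0 := by
    rw [← PadicInt.norm_def, PadicInt.isUnit_iff.mp u.isUnit]
    exact one_ne_zero
  rw [lam_eq_normLam hμ, ← normLam_iwasawaToPowerSeries, hι, map_mul, mul_assoc,
    normLam_C_mul hu]

omit [V.IsElliptic] in
/-- **Both halves with the same `λ` give GREENBERG–VATSAL ON THE BRANCH** (`X3BranchLambdaEqAt V p`):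
for a generator `g` of `char X_m` (`λ(g) = n` by the algebraic half) and a factorisation
`ι(g·h) = C(u·ϖ)·B` with `g·h` of unit content, `λ(g·h) = λ(ϖ·B) = n` by the analytic half and
scale invariance. Pure `Λ`-algebra; the two inputs are TYPED (nothing asserted).
[cite: GreenbergVatsal2000, p. 4 (after Thm. (1.2)) and p. 43] -/
theorem x3BranchLambdaEqAt_of_analyticLambda_of_algebraicLambda {n : ℕ}
    (hA : X3BranchAnalyticLambdaAt V p n) (hB : X3BranchAlgebraicLambdaAt V p n) :
    X3BranchLambdaEqAt V p := by
  intro K _ _ _ F _ _ _ _ κ γ N _ f B hp2 h2 hθ hred hirr hκ hγ hcyc hγK hγF hf D ϖ hϖ g h hchar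
    hfac hμg hμgh
  obtain ⟨u, hι⟩ := hfac
  have hg : lam g = n := (hB K F hp2 h2 hθ hirr hκ hγ hcyc hγK hγF D g hchar).2
  have hgh : lam (g * h) = n := by
    rw [lam_eq_normLam_of_iota_eq hμgh hι]
    exact (hA f B ϖ hred hf hϖ).2
  rw [hg, hgh]

/-- **The branch main conjecture from the two halves**, granted Wuthrich's PUBLISHED half-eigen
divisibility (Thm. 16, `hW`): the analytic half and the algebraic half with the same `λ = n` give
`X3BranchLambdaEqAt` and `X3BranchAnalyticMuZeroAt`, hence `X3BranchMainConjectureAt V p` by the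
tree's kernel `x3BranchMainConjectureAt_of_lambdaEq_of_muZero`. NOT a class theorem (two typed
inputs). [cite: Wuthrich2014, Thm. 16 (p. 397)] [cite: GreenbergVatsal2000, p. 4 and p. 43] -/
theorem x3BranchMainConjectureAt_of_analyticLambda_of_algebraicLambda
    (hW : Wuthrich2014.thm16_halfEigenCharIdeal_dvd_cyclotomicPrime) {n : ℕ}
    (hA : X3BranchAnalyticLambdaAt V p n) (hB : X3BranchAlgebraicLambdaAt V p n) :
    X3BranchMainConjectureAt V p :=
  x3BranchMainConjectureAt_of_lambdaEq_of_muZero hW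
    (x3BranchLambdaEqAt_of_analyticLambda_of_algebraicLambda hA hB)
    (x3BranchAnalyticMuZeroAt_of_analyticLambda hA)

omit [V.IsElliptic] in
/-- **Conversely the halves are NECESSARY in the `μ = 0` case**: the branch main conjecture together
with ONE analytic `λ`-value `n` (the analytic half) forces the algebraic half with the same `n` —
every generator `g` of `char X_m` is associated to Wuthrich's `g'` with `ι g' = C(uϖ)B`, so has
unit content and `λ(g) = λ(g') = n`. Hence, granted print and `μ_an = 0`, the decomposition's two
`λ = n` statements are EXACTLY the content of `X3BranchMainConjectureAt`.
[cite: GreenbergVatsal2000, p. 4 (after Thm. (1.2))] [cite: Wuthrich2014, Thm. 16 (p. 397)] -/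
theorem x3BranchAlgebraicLambdaAt_of_mainConjecture_of_analyticLambda
    (hmodD : ∀ (K : Type) [Field K] [NumberField K] [(galRange (K := ℚ) K).Normal]
      (F : Type) [Field F] [NumberField F] [IsCyclotomicExtension {p} ℚ F]
      [(galRange (K := ℚ) F).Normal] {κ : ZpExtension ℚ p} {γ : Field.absoluteGaloisGroup ℚ},
      p ≠ 2 → Module.finrank ℚ K = 2 →
      (∃ θ : K, θ ^ 2 = algebraMap ℚ K ((-1) ^ (p / 2) * p)) →
      ¬ V.HasIrreducibleModPGaloisRep p →
      κ.IsCyclotomic → κ.IsTopGenerator γ → IsCyclotomicVariable p γ →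
      γ ∈ galRange (K := ℚ) K → γ ∈ galRange (K := ℚ) F →
      ∃ (N : ℕ) (_ : NeZero N) (f : CuspForm (Gamma0 N) 2) (B : PowerSeries ℚ_[p]) (ϖ : ℚ),
        ((IsOrdinaryAt V p ∧
            B = if Even (p / 2) then padicLFunctionBranch f ((unitRoot V p : ℤ_[p]) : ℚ_[p]) (p / 2)
              else padicLFunctionMinusBranch f ((unitRoot V p : ℤ_[p]) : ℚ_[p]) (p / 2)) ∨
          (V.HasSplitMultiplicativeReductionAtPrime p ∧
            B = if Even (p / 2) then padicLFunctionPlusBranchMult f (1 : ℚ_[p]) (p / 2)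
              else padicLFunctionMinusBranchMult f (1 : ℚ_[p]) (p / 2)) ∨
          (V.HasMultiplicativeReductionAtPrime p ∧ ¬ V.HasSplitMultiplicativeReductionAtPrime p ∧
            B = if Even (p / 2) then padicLFunctionPlusBranchMult f (-1 : ℚ_[p]) (p / 2)
              else padicLFunctionMinusBranchMult f (-1 : ℚ_[p]) (p / 2))) ∧
        IsNewformOf V f ∧
        (if Even (p / 2) then (ϖ : ℝ) * V.realPeriodRat = plusPeriod f
          else (ϖ : ℝ) * V.imaginaryPeriodRat = minusPeriod f))
    (hMC : X3BranchMainConjectureAt V p) {n : ℕ} (hA : X3BranchAnalyticLambdaAt V p n) :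
    X3BranchAlgebraicLambdaAt V p n := by
  intro K _ _ _ F _ _ _ _ κ γ hp2 h2 hθ hirr hκ hγ hcyc hγK hγF D g hchar
  obtain ⟨N, _, f, B, ϖ, hred, hf, hϖ⟩ := hmodD K F hp2 h2 hθ hirr hκ hγ hcyc hγK hγF
  obtain ⟨-, g', hchar', u, hι⟩ := hMC K F B hp2 h2 hθ hred hirr hκ hγ hcyc hγK hγF hf D ϖ hϖ
  -- `(g) = (g')`, so `g` and `g'` have unit content together and the same `λ`
  have hspan : Ideal.span ({g} : Set (IwasawaAlgebra p)) = Ideal.span {g'} := hchar ▸ hchar'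
  have hμ' : HasUnitContent g' := hasUnitContent_of_iota_eq hι (hA f B ϖ hred hf hϖ).1
  have hμ : HasUnitContent g := (hasUnitContent_congr_of_span_eq hspan).mpr hμ'
  refine ⟨hμ, ?_⟩
  have hg0 : g ≠ 0 := X11a.ne_zero_of_hasUnitContent hμ
  have hg'0 : g' ≠ 0 := X11a.ne_zero_of_hasUnitContent hμ'
  obtain ⟨w, hw⟩ := Ideal.span_singleton_eq_span_singleton.mp hspan.symm
  -- `g' * w = g` with `w` a unit: `λ(g) = λ(g')`
  have hlam : lam g = lam g' := ((span_eq_span_iff_mu_lam hg'0 hg0 hw.symm).mp hspan).2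
  rw [hlam, lam_eq_normLam_of_iota_eq hμ' hι]
  exact (hA f B ϖ hred hf hϖ).2

end Kernel

/-! ### §4 The per-pair CERTIFICATE bypass of the analytic half: one unit coefficient at the
predicted index `n` closes the branch main conjecture, granted the algebraic half and Wuthrich -/

section Certificate

variable (V : WeierstrassCurve ℚ) [V.IsElliptic] [V.IsGloballyMinimal] (p : ℕ) [Fact p.Prime]

/-- **The unit-coefficient CERTIFICATE at index `n` on the branch** (per-pair, computable by
exact modular symbols — the `λ > 0` generalisation of the tree's unit-row certificate
`X3BranchAnalyticMuZeroAt` with witness `0`): in the telescope of `X3BranchAnalyticMuZeroAt V p`,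
the `n`-th coefficient of `ϖ·B` has `p`-adic norm `1`. It does NOT say that `n` is the first such
index (that is what the algebraic half supplies). A hypothesis shape; nothing asserted.
[cite: MazurTateTeitelbaum1986Invent, §I.13] [cite: GreenbergVatsal2000, p. 2, (1)–(2)] -/
def X3BranchUnitCoeffCertAt (n : ℕ) : Prop :=
  ∀ {N : ℕ} [NeZero N] (f : CuspForm (Gamma0 N) 2) (B : PowerSeries ℚ_[p]) (ϖ : ℚ),
    ((IsOrdinaryAt V p ∧
        B = if Even (p / 2) then padicLFunctionBranch f ((unitRoot V p : ℤ_[p]) : ℚ_[p]) (p / 2)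
          else padicLFunctionMinusBranch f ((unitRoot V p : ℤ_[p]) : ℚ_[p]) (p / 2)) ∨
      (V.HasSplitMultiplicativeReductionAtPrime p ∧
        B = if Even (p / 2) then padicLFunctionPlusBranchMult f (1 : ℚ_[p]) (p / 2)
          else padicLFunctionMinusBranchMult f (1 : ℚ_[p]) (p / 2)) ∨
      (V.HasMultiplicativeReductionAtPrime p ∧ ¬ V.HasSplitMultiplicativeReductionAtPrime p ∧
        B = if Even (p / 2) then padicLFunctionPlusBranchMult f (-1 : ℚ_[p]) (p / 2)
          else padicLFunctionMinusBranchMult f (-1 : ℚ_[p]) (p / 2))) →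
    IsNewformOf V f →
    (if Even (p / 2) then (ϖ : ℝ) * V.realPeriodRat = plusPeriod f
      else (ϖ : ℝ) * V.imaginaryPeriodRat = minusPeriod f) →
    ‖PowerSeries.coeff n (PowerSeries.C (ϖ : ℚ_[p]) * B)‖ = 1

end Certificate

section CertificateKernel

variable {V : WeierstrassCurve ℚ} [V.IsElliptic] [V.IsGloballyMinimal] {p : ℕ} [Fact p.Prime]

/-- **CERTIFICATE BYPASS**: the algebraic half with `λ = n` and ONE unit coefficient of `ϖ·B` at
the SAME index `n` give the branch main conjecture `X3BranchMainConjectureAt V p`, granted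
Wuthrich's published half (Thm. 16, `hW`) — no analytic congruence needed. Proof: Wuthrich gives
`g' = g·h ∈ char X_m = (g)` with `ι g' = C(uϖ)B`; the certificate gives `μ(g') = 0` and
`λ(g') ≤ n = λ(g)` (algebraic half; the tree's `hasUnitContent_and_lam_le_of_iota_eq_of_norm_coeff_eq_one`
of `Additive/CongruentPartnerMainConjecture.lean`, route G's unit-coefficient reading), so `(g') = (g)` by the generator criterion
`span_mul_eq_span_of_hasUnitContent_of_lam_le`. This generalises the tree's unit-row theorems
(`n = 0`) to every parity-OK pair. NOT a class theorem (typed algebraic half + per-pair certificate).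
[cite: Wuthrich2014, Thm. 16 (p. 397)] [cite: GreenbergVatsal2000, p. 4 (after Thm. (1.2))] -/
theorem x3BranchMainConjectureAt_of_algebraicLambda_of_unitCoeffCert
    (hW : Wuthrich2014.thm16_halfEigenCharIdeal_dvd_cyclotomicPrime) {n : ℕ}
    (hB : X3BranchAlgebraicLambdaAt V p n) (hC : X3BranchUnitCoeffCertAt V p n) :
    X3BranchMainConjectureAt V p := by
  intro K _ _ _ F _ _ _ _ κ γ N _ f B hp2 h2 hθ hred hirr hκ hγ hcyc hγK hγF hf D ϖ hϖ
  obtain ⟨htors, g', hg'mem, u, hι⟩ :=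
    hW p V K F B hp2 h2 hθ hred hirr hκ hγ hcyc hγK hγF hf D ϖ hϖ
  refine ⟨htors, ?_⟩
  obtain ⟨g, hg⟩ := (charIdeal_isPrincipal_holds p D.X).principal
  have hchar : D.charIdeal = Ideal.span {g} := hg
  obtain ⟨h, hfac⟩ : g ∣ g' := by
    rw [hchar] at hg'mem
    exact Ideal.mem_span_singleton.mp hg'mem
  subst hfac
  obtain ⟨hμg, hlamg⟩ := hB K F hp2 h2 hθ hirr hκ hγ hcyc hγK hγF D g hchar
  obtain ⟨hμ', hlam'⟩ :=
    hasUnitContent_and_lam_le_of_iota_eq_of_norm_coeff_eq_one hι (hC f B ϖ hred hf hϖ)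
  refine ⟨g * h, hchar.trans ?_, u, hι⟩
  exact (span_mul_eq_span_of_hasUnitContent_of_lam_le (X11a.ne_zero_of_hasUnitContent hμg) hμ'
    (hlamg ▸ hlam')).symm

end CertificateKernel

end Summit.BirchSwinnertonDyer.Rank1Residual.Additive.X3Branch

end
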